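import Mathlib
import Summits.NavierStokesRegularity.NavierStokesRegularity.Theorems.WakeRatchetTailRatchetPostFiringClock
import HarnessLib

/-!
# `WakeRatchet.TailRatchet` (stmt-NavierStokesRegularity-21808), door D4′ — the PHYSICAL ENERGY of a half-line
# solution of the renormalised dyadic lattice is conserved; the ENERGY LINE `W_k(σ) ≤ Λ^k e^{−σ} √E`

Def-free support lemmas (MODEL lattice ODEs: the scalar dyadic member of Tao 2016 §1.2 / §4 in the renormalised
variables of §6.4; nothing here concerns the Navier–Stokes equations; stmt-21808 is neither proved nor refuted here
and no stub of skeleton d00b85951d7c is closed).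

SETTING (as in `WakeRatchetTailRatchetPostFiringClock`): `W : ℤ → ℝ → ℝ` solves
`W_n' = −W_n + Λ W_{n−1}² − Λ⁻¹ W_n W_{n+1}` on `σ > A₀`, with `0 ≤ W_n(σ) ≤ B` for `σ ≥ A > A₀` and `W_n ≡ 0` for
`n < 0` there; `Λ > 1`.  In physical variables `X_n(t) = Λ^{-n} e^{σ} W_n(σ)` (`t = T* − e^{−σ}`), so the physical
energy is `E(σ) = Σ_{k≥0} Λ^{-2k} e^{2σ} W_k(σ)²`.

* `summable_energy` — the energy series converges (`W ≤ B`, `Λ > 1`);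
* `hasDerivAt_energy_zero` — `E' = 0` on `σ > A` (termwise differentiation with a geometric majorant; the flux
  terms `2e^{2σ}Λ^{1−2k} W_{k−1}² W_k` telescope and the `k = 0` flux vanishes because `W_{−1} ≡ 0`);
* `energy_conserved` — `E(σ₂) = E(σ₁)` for `A < σ₁ ≤ σ₂`;
* `energy_line` — `W_k(σ) ≤ Λ^k e^{−σ} √E(σ₁)` for `A < σ₁ ≤ σ`: every shell below the ENERGY LINE
  `k ≤ (σ + log η − ½ log E)/log Λ` is quiet (`≤ η`) at log-time `σ`, unconditionally (`le_of_energy_line`).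

For the quiet-times estimate (QT) of the door this disposes of the deep wake (in the numerics of
CENSUS-21808-leafhand4-g17.md: the shells `k ≲ θ n`, `θ = T/log Λ ≈ 0.73`, at the firing time of shell `n`); the
band between the energy line and the front is what (QT) is about.

HONEST FRAMING: elementary real analysis; (D)/(QT) are NOT proved here; rung 0.
-/

noncomputable section

set_option linter.dupNamespace false

namespace Summit.NavierStokesRegularity.NavierStokesRegularity.Theorems

namespace WakeRatchetDyadicPostFiring

open Set Filter Topology

variable {Λ : ℝ} {W : ℤ → ℝ → ℝ} {A₀ A B : ℝ}

/-! ## Summability -/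

/-- `Λ⁻¹^{2k} = (Λ⁻²)^k`. [folklore] -/
theorem inv_pow_two_mul (Λ : ℝ) (k : ℕ) : Λ⁻¹ ^ (2 * k) = (Λ⁻¹ ^ 2) ^ k := pow_mul Λ⁻¹ 2 k

/-- For `Λ > 1`: `0 ≤ Λ⁻² < 1`. [folklore] -/
theorem inv_sq_lt_one (hΛ : 1 < Λ) : 0 ≤ Λ⁻¹ ^ 2 ∧ Λ⁻¹ ^ 2 < 1 := by
  have h0 : 0 < Λ := by linarith
  have h1 : 0 ≤ Λ⁻¹ := (inv_pos.2 h0).le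
  have h2 : Λ⁻¹ < 1 := inv_lt_one_of_one_lt₀ hΛ
  exact ⟨by positivity, by nlinarith⟩

/-- A geometric majorant: `|c_k| ≤ K (Λ⁻²)^k` with `Λ > 1` is summable. [folklore] -/
theorem summable_of_le_geometric (hΛ : 1 < Λ) {f : ℕ → ℝ} {K : ℝ}
    (hf : ∀ k, |f k| ≤ K * (Λ⁻¹ ^ 2) ^ k) : Summable f := by
  obtain ⟨h0, h1⟩ := inv_sq_lt_one hΛ
  refine Summable.of_norm_bounded ((summable_geometric_of_lt_one h0 h1).mul_left K) fun k => ?_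
  rw [Real.norm_eq_abs]
  exact hf k

/-- **The energy series converges** (`0 ≤ W ≤ B` at `σ ≥ A`, `Λ > 1`).
[cite: Tao2016AveragedNS, §1.2 (dyadic model: conserved energy `Σ X_n²`), §4 Lemma 4.1 (4.10) in the variables of §6.4; elementary] -/
theorem summable_energy (hΛ : 1 < Λ)
    (hnn : ∀ (n : ℤ) (σ : ℝ), A ≤ σ → 0 ≤ W n σ) (hB : ∀ (n : ℤ) (σ : ℝ), A ≤ σ → W n σ ≤ B)
    {σ : ℝ} (hσ : A ≤ σ) :
    Summable fun k : ℕ => Λ⁻¹ ^ (2 * k) * (Real.exp (2 * σ) * W k σ ^ 2) := by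
  refine summable_of_le_geometric hΛ (K := Real.exp (2 * σ) * B ^ 2) fun k => ?_
  have h0 : 0 ≤ W k σ := hnn k σ hσ
  have h1 : W k σ ≤ B := hB k σ hσ
  have hsq : W k σ ^ 2 ≤ B ^ 2 := pow_le_pow_left₀ h0 h1 2
  have hr : 0 ≤ (Λ⁻¹ ^ 2) ^ k := pow_nonneg (inv_sq_lt_one hΛ).1 k
  rw [inv_pow_two_mul, abs_of_nonneg (by positivity)]
  calc (Λ⁻¹ ^ 2) ^ k * (Real.exp (2 * σ) * W k σ ^ 2)
      ≤ (Λ⁻¹ ^ 2) ^ k * (Real.exp (2 * σ) * B ^ 2) := by gcongr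
    _ = Real.exp (2 * σ) * B ^ 2 * (Λ⁻¹ ^ 2) ^ k := by ring

/-! ## Conservation -/

/-- **The physical energy has zero derivative** on `σ > A`: termwise differentiation (geometric majorant on
`(A, T)`) and telescoping of the fluxes `2e^{2σ}Λ^{1−2k}W_{k−1}²W_k`, the `k = 0` flux vanishing by `W_{−1} ≡ 0`.
[cite: Tao2016AveragedNS, §1.2 (dyadic model: the nonlinearity conserves `Σ X_n²`), §4 (4.3)/(4.10), §6.4; elementary] -/
theorem hasDerivAt_energy_zero (hΛ : 1 < Λ) (hA : A₀ < A)
    (hlaw : ∀ (n : ℤ) (σ : ℝ), A₀ < σ → HasDerivAt (W n)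
      (-(W n σ) + Λ * W (n - 1) σ ^ 2 - Λ⁻¹ * W n σ * W (n + 1) σ) σ)
    (hnn : ∀ (n : ℤ) (σ : ℝ), A ≤ σ → 0 ≤ W n σ) (hB : ∀ (n : ℤ) (σ : ℝ), A ≤ σ → W n σ ≤ B)
    (hneg : ∀ n : ℤ, n < 0 → ∀ σ : ℝ, A ≤ σ → W n σ = 0) {σ : ℝ} (hσ : A < σ) :
    HasDerivAt (fun y => ∑' k : ℕ, Λ⁻¹ ^ (2 * k) * (Real.exp (2 * y) * W k y ^ 2)) 0 σ := by
  have hΛ0 : 0 < Λ := by linarith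
  have hΛne : Λ ≠ 0 := hΛ0.ne'
  have hB0 : 0 ≤ B := (hnn 0 σ hσ.le).trans (hB 0 σ hσ.le)
  obtain ⟨hr0, hr1⟩ := inv_sq_lt_one hΛ
  -- the window `t = (A, σ + 1)`
  set T : ℝ := σ + 1 with hT
  set t : Set ℝ := Ioo A T with ht
  have hσt : σ ∈ t := ⟨hσ, by rw [hT]; linarith⟩
  -- terms, derivatives, fluxes
  set F : ℕ → ℝ → ℝ := fun k y => Λ⁻¹ ^ (2 * k) * (Real.exp (2 * y) * W k y ^ 2) with hF
  set D : ℕ → ℝ → ℝ := fun k y =>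
    -(W k y) + Λ * W ((k : ℤ) - 1) y ^ 2 - Λ⁻¹ * W k y * W ((k : ℤ) + 1) y with hD
  set F' : ℕ → ℝ → ℝ := fun k y =>
    Λ⁻¹ ^ (2 * k) * (2 * Real.exp (2 * y) * W k y ^ 2 + Real.exp (2 * y) * (2 * W k y * D k y)) with hF'
  -- (1) termwise derivatives on `t`
  have hderiv : ∀ (k : ℕ) (y : ℝ), y ∈ t → HasDerivAt (F k) (F' k y) y := by
    intro k y hy
    have hy₀ : A₀ < y := hA.trans hy.1
    have hW : HasDerivAt (W k) (D k y) y := hlaw k y hy₀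
    have hsq : HasDerivAt (fun x => W k x ^ 2) (2 * W k y * D k y) y := by
      have h := hW.mul hW
      have e : (fun x => W k x ^ 2) = fun x => W k x * W k x := by funext x; ring
      rw [e]
      exact h.congr_deriv (by ring)
    have hexp : HasDerivAt (fun x => Real.exp (2 * x)) (2 * Real.exp (2 * y)) y := by
      have h := ((hasDerivAt_id' y).const_mul (2 : ℝ)).exp
      exact h.congr_deriv (by ring)
    have h : HasDerivAt (fun x => Λ⁻¹ ^ (2 * k) * (Real.exp (2 * x) * W k x ^ 2))
        (Λ⁻¹ ^ (2 * k) * (2 * Real.exp (2 * y) * W k y ^ 2 + Real.exp (2 * y) * (2 * W k y * D k y))) y :=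
      (hexp.mul hsq).const_mul (Λ⁻¹ ^ (2 * k))
    simpa only [hF, hF'] using h
  -- (2) a geometric majorant of the termwise derivatives on `t`
  set K : ℝ := Real.exp (2 * T) * (2 * B ^ 2 + 2 * B * (B + Λ * B ^ 2 + Λ⁻¹ * B ^ 2)) with hK
  have hbound : ∀ (k : ℕ) (y : ℝ), y ∈ t → ‖F' k y‖ ≤ K * (Λ⁻¹ ^ 2) ^ k := by
    intro k y hy
    have hyA : A ≤ y := hy.1.le
    have h0 : 0 ≤ W k y := hnn k y hyA
    have h1 : W k y ≤ B := hB k y hyA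
    have hm0 : 0 ≤ W ((k : ℤ) - 1) y := hnn _ y hyA
    have hm1 : W ((k : ℤ) - 1) y ≤ B := hB _ y hyA
    have hp0 : 0 ≤ W ((k : ℤ) + 1) y := hnn _ y hyA
    have hp1 : W ((k : ℤ) + 1) y ≤ B := hB _ y hyA
    have he0 : 0 < Real.exp (2 * y) := Real.exp_pos _
    have heT : Real.exp (2 * y) ≤ Real.exp (2 * T) := Real.exp_le_exp.2 (by linarith [hy.2])
    have hΛi : 0 ≤ Λ⁻¹ := (inv_pos.2 hΛ0).le
    -- |D| ≤ B + ΛB² + Λ⁻¹B²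
    have hDabs : |D k y| ≤ B + Λ * B ^ 2 + Λ⁻¹ * B ^ 2 := by
      have ha : |-(W k y)| ≤ B := by rw [abs_neg, abs_of_nonneg h0]; exact h1
      have hb : |Λ * W ((k : ℤ) - 1) y ^ 2| ≤ Λ * B ^ 2 := by
        rw [abs_of_nonneg (by positivity)]
        exact mul_le_mul_of_nonneg_left (pow_le_pow_left₀ hm0 hm1 2) hΛ0.le
      have hc : |Λ⁻¹ * W k y * W ((k : ℤ) + 1) y| ≤ Λ⁻¹ * B ^ 2 := by
        rw [abs_of_nonneg (by positivity)]
        calc Λ⁻¹ * W k y * W ((k : ℤ) + 1) y ≤ Λ⁻¹ * B * B := by gcongr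
          _ = Λ⁻¹ * B ^ 2 := by ring
      have hD' : D k y = -(W k y) + Λ * W ((k : ℤ) - 1) y ^ 2 + -(Λ⁻¹ * W k y * W ((k : ℤ) + 1) y) := by
        simp only [hD]; ring
      rw [hD']
      refine (abs_add_three _ _ _).trans ?_
      have hc' : |-(Λ⁻¹ * W k y * W ((k : ℤ) + 1) y)| ≤ Λ⁻¹ * B ^ 2 := by rw [abs_neg]; exact hc
      linarith
    have hinner : |2 * Real.exp (2 * y) * W k y ^ 2 + Real.exp (2 * y) * (2 * W k y * D k y)|
        ≤ K := by
      have hsq : W k y ^ 2 ≤ B ^ 2 := pow_le_pow_left₀ h0 h1 2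
      have h2 : |2 * W k y * D k y| ≤ 2 * B * (B + Λ * B ^ 2 + Λ⁻¹ * B ^ 2) := by
        rw [abs_mul, abs_of_nonneg (by positivity)]
        exact mul_le_mul (by linarith) hDabs (abs_nonneg _) (by positivity)
      calc |2 * Real.exp (2 * y) * W k y ^ 2 + Real.exp (2 * y) * (2 * W k y * D k y)|
          ≤ |2 * Real.exp (2 * y) * W k y ^ 2| + |Real.exp (2 * y) * (2 * W k y * D k y)| := abs_add_le _ _
        _ = Real.exp (2 * y) * (2 * W k y ^ 2) + Real.exp (2 * y) * |2 * W k y * D k y| := by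
            rw [abs_of_nonneg (by positivity), abs_mul, abs_of_pos he0]; ring
        _ ≤ Real.exp (2 * T) * (2 * B ^ 2) + Real.exp (2 * T) * (2 * B * (B + Λ * B ^ 2 + Λ⁻¹ * B ^ 2)) := by
            gcongr
        _ = K := by rw [hK]; ring
    have hck : 0 ≤ (Λ⁻¹ ^ 2) ^ k := pow_nonneg hr0 k
    rw [Real.norm_eq_abs]
    simp only [hF']
    rw [abs_mul, inv_pow_two_mul, abs_of_nonneg hck, mul_comm]
    exact mul_le_mul_of_nonneg_right hinner hck
  -- (3) termwise differentiation
  have hsum0 : Summable fun k => F k σ := summable_energy hΛ hnn hB hσ.le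
  have hE : HasDerivAt (fun y => ∑' k : ℕ, F k y) (∑' k : ℕ, F' k σ) σ :=
    hasDerivAt_tsum_of_isPreconnected ((summable_geometric_of_lt_one hr0 hr1).mul_left K) isOpen_Ioo
      isPreconnected_Ioo hderiv hbound hσt hsum0 hσt
  -- (4) the derivative series telescopes to `0`
  set g : ℕ → ℝ := fun k => 2 * Real.exp (2 * σ) * (Λ * Λ⁻¹ ^ (2 * k)) * (W ((k : ℤ) - 1) σ ^ 2 * W k σ)
    with hg
  have hFg : ∀ k : ℕ, F' k σ = g k - g (k + 1) := by
    intro k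
    have hpow : Λ * Λ⁻¹ ^ (2 * (k + 1)) = Λ⁻¹ ^ (2 * k) * Λ⁻¹ := by
      rw [show 2 * (k + 1) = 2 * k + 2 by ring, pow_add]
      field_simp
    have hcast1 : (((k + 1 : ℕ) : ℤ) - 1) = (k : ℤ) := by push_cast; ring
    have hcast2 : (((k + 1 : ℕ) : ℤ)) = (k : ℤ) + 1 := by push_cast; ring
    have hg1 : g (k + 1) = 2 * Real.exp (2 * σ) * (Λ⁻¹ ^ (2 * k) * Λ⁻¹) * (W (k : ℤ) σ ^ 2 * W ((k : ℤ) + 1) σ) := by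
      simp only [hg]
      rw [hcast1, hcast2, hpow]
    rw [hg1]
    simp only [hF', hg, hD]
    ring
  have hgs : Summable g := by
    refine summable_of_le_geometric hΛ (K := 2 * Real.exp (2 * σ) * Λ * B ^ 3) fun k => ?_
    have hyA : A ≤ σ := hσ.le
    have h0 : 0 ≤ W k σ := hnn k σ hyA
    have h1 : W k σ ≤ B := hB k σ hyA
    have hm0 : 0 ≤ W ((k : ℤ) - 1) σ := hnn _ σ hyA
    have hm1 : W ((k : ℤ) - 1) σ ≤ B := hB _ σ hyA
    have hck : 0 ≤ (Λ⁻¹ ^ 2) ^ k := pow_nonneg hr0 k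
    simp only [hg]
    rw [inv_pow_two_mul, abs_of_nonneg (by positivity)]
    calc 2 * Real.exp (2 * σ) * (Λ * (Λ⁻¹ ^ 2) ^ k) * (W ((k : ℤ) - 1) σ ^ 2 * W (k : ℤ) σ)
        ≤ 2 * Real.exp (2 * σ) * (Λ * (Λ⁻¹ ^ 2) ^ k) * (B ^ 2 * B) :=
          mul_le_mul_of_nonneg_left (mul_le_mul (pow_le_pow_left₀ hm0 hm1 2) h1 h0 (by positivity))
            (by positivity)
      _ = 2 * Real.exp (2 * σ) * Λ * B ^ 3 * (Λ⁻¹ ^ 2) ^ k := by ring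
  have hg0 : g 0 = 0 := by
    have h := hneg (((0 : ℕ) : ℤ) - 1) (by norm_num) σ hσ.le
    simp only [hg, h]
    ring
  have hgs' : Summable fun k => g (k + 1) := (summable_nat_add_iff 1).2 hgs
  have htel : ∑' k : ℕ, F' k σ = 0 := by
    have h1 : (fun k => F' k σ) = fun k => g k - g (k + 1) := funext hFg
    rw [h1, hgs.tsum_sub hgs', hgs.tsum_eq_zero_add, hg0]
    ring
  rw [htel] at hE
  exact hE

/-- **Energy conservation**: `E(σ₂) = E(σ₁)` for `A < σ₁ ≤ σ₂`.
[cite: Tao2016AveragedNS, §1.2 (dyadic model: conserved energy), §4 (4.3)/(4.10), §6.4; elementary] -/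
theorem energy_conserved (hΛ : 1 < Λ) (hA : A₀ < A)
    (hlaw : ∀ (n : ℤ) (σ : ℝ), A₀ < σ → HasDerivAt (W n)
      (-(W n σ) + Λ * W (n - 1) σ ^ 2 - Λ⁻¹ * W n σ * W (n + 1) σ) σ)
    (hnn : ∀ (n : ℤ) (σ : ℝ), A ≤ σ → 0 ≤ W n σ) (hB : ∀ (n : ℤ) (σ : ℝ), A ≤ σ → W n σ ≤ B)
    (hneg : ∀ n : ℤ, n < 0 → ∀ σ : ℝ, A ≤ σ → W n σ = 0) {σ₁ σ₂ : ℝ} (hσ₁ : A < σ₁) (h12 : σ₁ ≤ σ₂) :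
    ∑' k : ℕ, Λ⁻¹ ^ (2 * k) * (Real.exp (2 * σ₂) * W k σ₂ ^ 2)
      = ∑' k : ℕ, Λ⁻¹ ^ (2 * k) * (Real.exp (2 * σ₁) * W k σ₁ ^ 2) := by
  set E : ℝ → ℝ := fun y => ∑' k : ℕ, Λ⁻¹ ^ (2 * k) * (Real.exp (2 * y) * W k y ^ 2) with hEdef
  have hd : ∀ y, A < y → HasDerivAt E 0 y := fun y hy =>
    hasDerivAt_energy_zero hΛ hA hlaw hnn hB hneg hy
  have hcont : ContinuousOn E (Icc σ₁ σ₂) := fun y hy =>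
    (hd y (hσ₁.trans_le hy.1)).continuousAt.continuousWithinAt
  have hder : ∀ y ∈ Ico σ₁ σ₂, HasDerivWithinAt E 0 (Ici y) y := fun y hy =>
    (hd y (hσ₁.trans_le hy.1)).hasDerivWithinAt
  exact constant_of_has_deriv_right_zero hcont hder σ₂ (right_mem_Icc.2 h12)

/-! ## The energy line -/

/-- **One shell is below the total energy**: `Λ^{-2k} e^{2σ} W_k(σ)² ≤ E(σ)`.
[cite: Tao2016AveragedNS, §1.2, §4 (4.10), §6.4; elementary] -/
theorem term_le_energy (hΛ : 1 < Λ)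
    (hnn : ∀ (n : ℤ) (σ : ℝ), A ≤ σ → 0 ≤ W n σ) (hB : ∀ (n : ℤ) (σ : ℝ), A ≤ σ → W n σ ≤ B)
    {σ : ℝ} (hσ : A ≤ σ) (k : ℕ) :
    Λ⁻¹ ^ (2 * k) * (Real.exp (2 * σ) * W k σ ^ 2)
      ≤ ∑' j : ℕ, Λ⁻¹ ^ (2 * j) * (Real.exp (2 * σ) * W j σ ^ 2) := by
  have hs := summable_energy hΛ hnn hB hσ
  have hΛi : 0 ≤ Λ⁻¹ := (inv_pos.2 (by linarith : (0 : ℝ) < Λ)).le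
  exact hs.le_tsum k fun j _ => by positivity

/-- **The energy line.**  For `A < σ₁ ≤ σ`: `W_k(σ) ≤ Λ^k e^{−σ} √E(σ₁)` — the renormalised amplitude of shell `k` is
below `η` as soon as `Λ^k ≤ η e^{σ}/√E(σ₁)`, i.e. for all shells `k ≤ (σ + log η − ½ log E(σ₁))/log Λ`.
[cite: Tao2016AveragedNS, §1.2 (dyadic model: conserved energy), §4 (4.10), §6.4; elementary] -/
theorem energy_line (hΛ : 1 < Λ) (hA : A₀ < A)
    (hlaw : ∀ (n : ℤ) (σ : ℝ), A₀ < σ → HasDerivAt (W n)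
      (-(W n σ) + Λ * W (n - 1) σ ^ 2 - Λ⁻¹ * W n σ * W (n + 1) σ) σ)
    (hnn : ∀ (n : ℤ) (σ : ℝ), A ≤ σ → 0 ≤ W n σ) (hB : ∀ (n : ℤ) (σ : ℝ), A ≤ σ → W n σ ≤ B)
    (hneg : ∀ n : ℤ, n < 0 → ∀ σ : ℝ, A ≤ σ → W n σ = 0) {σ₁ σ : ℝ} (hσ₁ : A < σ₁) (h1 : σ₁ ≤ σ)
    (k : ℕ) :
    W k σ ≤ Λ ^ k * Real.exp (-σ)
      * Real.sqrt (∑' j : ℕ, Λ⁻¹ ^ (2 * j) * (Real.exp (2 * σ₁) * W j σ₁ ^ 2)) := by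
  have hΛ0 : 0 < Λ := by linarith
  set E₁ : ℝ := ∑' j : ℕ, Λ⁻¹ ^ (2 * j) * (Real.exp (2 * σ₁) * W j σ₁ ^ 2) with hE₁
  have hσA : A ≤ σ := hσ₁.le.trans h1
  have hk := term_le_energy hΛ hnn hB hσA k
  rw [energy_conserved hΛ hA hlaw hnn hB hneg hσ₁ h1] at hk
  -- `W_k(σ)² ≤ (Λ^k e^{−σ})² E₁`
  have hW0 : 0 ≤ W k σ := hnn k σ hσA
  have hE0 : 0 ≤ E₁ := le_trans (by positivity) hk
  have hc : 0 < Λ ^ k * Real.exp (-σ) := by positivity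
  have hid : (Λ ^ k * Real.exp (-σ)) ^ 2 * (Λ⁻¹ ^ (2 * k) * (Real.exp (2 * σ) * W k σ ^ 2)) = W k σ ^ 2 := by
    have e1 : Real.exp (-σ) ^ 2 * Real.exp (2 * σ) = 1 := by
      rw [← Real.exp_nat_mul, ← Real.exp_add, show ((2 : ℕ) : ℝ) * -σ + 2 * σ = 0 by push_cast; ring,
        Real.exp_zero]
    have e2 : (Λ ^ k) ^ 2 * Λ⁻¹ ^ (2 * k) = 1 := by
      rw [inv_pow, mul_comm 2 k, pow_mul, mul_inv_cancel₀ (pow_ne_zero _ (pow_ne_zero _ hΛ0.ne'))]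
    calc (Λ ^ k * Real.exp (-σ)) ^ 2 * (Λ⁻¹ ^ (2 * k) * (Real.exp (2 * σ) * W k σ ^ 2))
        = ((Λ ^ k) ^ 2 * Λ⁻¹ ^ (2 * k)) * (Real.exp (-σ) ^ 2 * Real.exp (2 * σ)) * W k σ ^ 2 := by ring
      _ = W k σ ^ 2 := by rw [e1, e2]; ring
  have hsq : W k σ ^ 2 ≤ (Λ ^ k * Real.exp (-σ) * Real.sqrt E₁) ^ 2 := by
    rw [mul_pow, Real.sq_sqrt hE0, ← hid]
    exact mul_le_mul_of_nonneg_left hk (by positivity)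
  have hR : 0 ≤ Λ ^ k * Real.exp (-σ) * Real.sqrt E₁ := by positivity
  exact (pow_le_pow_iff_left₀ hW0 hR two_ne_zero).1 hsq

/-- **Quiet below the energy line.**  With `A < σ₁ ≤ σ`, `0 ≤ η` and `Λ^k e^{−σ} √E(σ₁) ≤ η`: `W_k(σ) ≤ η`.
[cite: Tao2016AveragedNS, §1.2, §4 (4.10), §6.4; elementary] -/
theorem le_of_energy_line (hΛ : 1 < Λ) (hA : A₀ < A)
    (hlaw : ∀ (n : ℤ) (σ : ℝ), A₀ < σ → HasDerivAt (W n)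
      (-(W n σ) + Λ * W (n - 1) σ ^ 2 - Λ⁻¹ * W n σ * W (n + 1) σ) σ)
    (hnn : ∀ (n : ℤ) (σ : ℝ), A ≤ σ → 0 ≤ W n σ) (hB : ∀ (n : ℤ) (σ : ℝ), A ≤ σ → W n σ ≤ B)
    (hneg : ∀ n : ℤ, n < 0 → ∀ σ : ℝ, A ≤ σ → W n σ = 0) {σ₁ σ η : ℝ} (hσ₁ : A < σ₁) (h1 : σ₁ ≤ σ)
    (k : ℕ) (hk : Λ ^ k * Real.exp (-σ)
      * Real.sqrt (∑' j : ℕ, Λ⁻¹ ^ (2 * j) * (Real.exp (2 * σ₁) * W j σ₁ ^ 2)) ≤ η) :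
    W k σ ≤ η :=
  (energy_line hΛ hA hlaw hnn hB hneg hσ₁ h1 k).trans hk

end WakeRatchetDyadicPostFiring

end Summit.NavierStokesRegularity.NavierStokesRegularity.Theorems

end
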